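import Summits.AtomisticToContinuum.Crystallization.Theorems.FrustratedLawDichotomyStrainedPatchHomForceCentredFam

/-!
# (C′-2) FORCE/EXEMPT PRUNE, centred form — soundness V: ★★★ `forceOutC_sound_of_parts`
# (27623 strained-patch piece, hcp half; decomp-a2c hand-2 g28)

`dirOK en ed`, `checkA … cA`, `checkB … cB` and `slopeTestOK (boundC c w cA cB) sn sd` — the kernel facts of the centred leaf `…HomForceCentred.forceOutC`
— give, for every `U` (`‖U − 1‖ ≤ 1/4`) with entries in the box and every `ξ` (`‖ξ‖ ≤ 1/4`) in the shuffle box, the `hver` prune disjunct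
`Tight ∨ ExemptNear (9/5) ExRec z c ∨ Bad` for every injective enumeration of the homogeneous hcp `133/10`-ball — the same shape as
`…HomForceNest.forceOut_sound_of_parts`, via hand-1's `…HomExemptMoveBox.exemptNear_of_boxSlope` with `b := −boundC/SC`.
NO definitions; 0 sorry; axioms standard.  `--supports stmt-AtomisticToContinuum-27623`.
-/

namespace Summit.AtomisticToContinuum.Crystallization.Theorems.FrustratedLawDichotomyStrainedPatchHomForceCentredFinal

open scoped BigOperators RealInnerProductSpace
open Literature.Analysis.ValidatedNumerics.Numerics
open Summit.AtomisticToContinuum.Crystallization.Theorems.ChargedEnergyGapNegative (E3)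
open Summit.AtomisticToContinuum.Crystallization.Theorems.FrustratedLawDichotomyAveragingRuleTightFree (TightNearCap BadNearCap)
open Summit.AtomisticToContinuum.Crystallization.Theorems.FrustratedLawDichotomyExemptAbsorption (ExemptNear)
open Summit.AtomisticToContinuum.Crystallization.Theorems.FrustratedLawDichotomyStrainedPatchHomSplit
open Summit.AtomisticToContinuum.Crystallization.Theorems.FrustratedLawDichotomyStrainedPatchHomEntryGram (entryFI mem_entryFI)
open Summit.AtomisticToContinuum.Crystallization.Theorems.FrustratedLawDichotomyStrainedPatchHomEntryGramHcp (dot3 mem_dot3 shufFI mem_shufFI)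
open Summit.AtomisticToContinuum.Crystallization.Theorems.FrustratedLawDichotomyStrainedPatchHomForceKit
open Summit.AtomisticToContinuum.Crystallization.Theorems.FrustratedLawDichotomyStrainedPatchHomForceSum
  (cutSlope box11 box11_eq icc11 slopeTestOK dirOK lt_threshold_of_slopeTestOK norm_dirVec_le_one)
open Summit.AtomisticToContinuum.Crystallization.Theorems.FrustratedLawDichotomyStrainedPatchHomExemptMove (exemptNear_of_boxSlope)
open Summit.AtomisticToContinuum.Crystallization.Theorems.FrustratedLawDichotomyStrainedPatchHomForceCentred
open Summit.AtomisticToContinuum.Crystallization.Theorems.FrustratedLawDichotomyStrainedPatchHomForceCentredSound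
open Summit.AtomisticToContinuum.Crystallization.Theorems.FrustratedLawDichotomyStrainedPatchHomForceCentredLeaf
open Summit.AtomisticToContinuum.Crystallization.Theorems.FrustratedLawDichotomyStrainedPatchHomForceCentredFam

/-- Interval containment transports membership. [formal bookkeeping] -/
theorem mem_of_subFI {x : ℝ} {I J : FI} (hx : FI.mem x I) (h : subFI I J = true) : FI.mem x J := by
  simp only [subFI, Bool.and_eq_true, decide_eq_true_eq] at h
  obtain ⟨h1, h2⟩ := FI.mem_def.1 hx
  have h3 : ((J.lo : ℤ) : ℝ) ≤ I.lo := by exact_mod_cast h.1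
  have h4 : ((I.hi : ℤ) : ℝ) ≤ J.hi := by exact_mod_cast h.2
  exact FI.mem_def.2 ⟨h3.trans h1, h2.trans h4⟩

/-- Unpacking `Acc.check`. [formal bookkeeping] -/
theorem check_sound {acc : Acc} {cert : FamCert} (h : acc.check cert = true) :
    acc.ok = true ∧ acc.val ≤ cert.cval ∧ acc.nv ≤ cert.cnv ∧ acc.rem ≤ cert.crem ∧
      (∀ ac : Fin 3 × Fin 3, subFI (acc.K ac) (cert.cK ac) = true) ∧ (∀ a : Fin 3, subFI (acc.S a) (cert.cS a) = true) := by
  simp only [Acc.check, subAll, Bool.and_eq_true, decide_eq_true_eq] at h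
  refine ⟨by tauto, by tauto, by tauto, by tauto, fun ac => ?_, fun a => ?_⟩
  · obtain ⟨a, b⟩ := ac
    fin_cases a <;> fin_cases b <;> tauto
  · fin_cases a <;> tauto

/-- `x/S² ≤ ⌈⌈x/S⌉/S⌉`. [arithmetic] -/
theorem div_sq_le_cdiv_cdiv (x : ℤ) : (x : ℝ) / ((SC : ℝ) * SC) ≤ ((cdiv (cdiv x SC) SC : ℤ) : ℝ) := by
  have hS := SC_pos
  have h1 := div_le_cdiv (a := x) (b := SC) SCZ_pos
  have h2 := div_le_cdiv (a := cdiv x SC) (b := SC) SCZ_pos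
  push_cast at h1 h2
  calc (x : ℝ) / ((SC : ℝ) * SC) = (x : ℝ) / SC / SC := by rw [div_div]
    _ ≤ ((cdiv x SC : ℤ) : ℝ) / SC := div_le_div_of_nonneg_right h1 hS.le
    _ ≤ _ := h2

/-- ★ The ENTRY first-order terms are dominated by `entryTerm`. [folklore] -/
theorem entry_term_bound {c w : (Fin 3 × Fin 3) ⊕ Fin 3 → ℤ} {U : E3 →L[ℝ] E3} {cA cB : FamCert} {κA κB : Fin 3 × Fin 3 → ℝ}
    (hbox : ∀ ab : Fin 3 × Fin 3, |(U (EuclideanSpace.single ab.2 (1 : ℝ))) ab.1 - (c (Sum.inl ab) : ℝ) / SC| ≤ (w (Sum.inl ab) : ℝ) / SC)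
    (hmA : ∀ ac, FI.mem (κA ac) (cA.cK ac)) (hmB : ∀ ac, FI.mem (κB ac) (cB.cK ac)) :
    SC * ∑ ac : Fin 3 × Fin 3, ((U (EuclideanSpace.single ac.2 (1 : ℝ))) ac.1 - (c (Sum.inl ac) : ℝ) / SC) * (κA ac + κB ac) ≤
      (entryTerm w cA cB : ℝ) := by
  have hS := SC_pos
  have hent : ∀ ac : Fin 3 × Fin 3, SC * (((U (EuclideanSpace.single ac.2 (1 : ℝ))) ac.1 - (c (Sum.inl ac) : ℝ) / SC) * (κA ac + κB ac)) ≤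
      ((cdiv (w (Sum.inl ac) * FI.absHi ((cA.cK ac).add (cB.cK ac))) SC : ℤ) : ℝ) := by
    intro ac
    have habs := FI.abs_le_absHi (FI.mem_add (hmA ac) (hmB ac))
    have hΔ := hbox ac
    have hc := div_le_cdiv (a := w (Sum.inl ac) * FI.absHi ((cA.cK ac).add (cB.cK ac))) (b := SC) SCZ_pos
    push_cast at hc
    refine le_trans ?_ hc
    rw [le_div_iff₀ hS]
    have hwn : (0 : ℝ) ≤ (w (Sum.inl ac) : ℝ) / SC := le_trans (abs_nonneg _) hΔ
    calc SC * (((U (EuclideanSpace.single ac.2 (1 : ℝ))) ac.1 - (c (Sum.inl ac) : ℝ) / SC) * (κA ac + κB ac)) * SC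
        ≤ |SC * (((U (EuclideanSpace.single ac.2 (1 : ℝ))) ac.1 - (c (Sum.inl ac) : ℝ) / SC) * (κA ac + κB ac)) * SC| := le_abs_self _
      _ = (|(U (EuclideanSpace.single ac.2 (1 : ℝ))) ac.1 - (c (Sum.inl ac) : ℝ) / SC| * SC) * (|κA ac + κB ac| * SC) := by
          simp only [abs_mul, abs_of_pos hS]; ring
      _ ≤ ((w (Sum.inl ac) : ℝ) / SC * SC) * (FI.absHi ((cA.cK ac).add (cB.cK ac)) : ℝ) :=
          mul_le_mul (mul_le_mul_of_nonneg_right hΔ hS.le) habs (by positivity) (by positivity)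
      _ = (w (Sum.inl ac) : ℝ) * (FI.absHi ((cA.cK ac).add (cB.cK ac)) : ℝ) := by field_simp
  rw [Finset.mul_sum]
  have e : (entryTerm w cA cB : ℝ) = ∑ ac : Fin 3 × Fin 3, ((cdiv (w (Sum.inl ac) * FI.absHi ((cA.cK ac).add (cB.cK ac))) SC : ℤ) : ℝ) := by
    rw [Fintype.sum_prod_type]
    simp only [Fin.sum_univ_three]
    unfold entryTerm
    push_cast
    ring
  rw [e]
  exact Finset.sum_le_sum fun ac _ => hent ac

/-- ★ The SHUFFLE first-order terms are dominated by `shufTerm`. [folklore] -/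
theorem shuf_term_bound {c w : (Fin 3 × Fin 3) ⊕ Fin 3 → ℤ} {ξ : E3} {cB : FamCert} {σB : Fin 3 → ℝ}
    (hξ : ∀ i : Fin 3, |ξ i - (c (Sum.inr i) : ℝ) / SC| ≤ (w (Sum.inr i) : ℝ) / SC) (hσ : ∀ a, FI.mem (σB a) (cB.cS a)) :
    SC * ∑ i : Fin 3, (ξ i - (c (Sum.inr i) : ℝ) / SC) * ∑ a : Fin 3, ((c (Sum.inl (a, i)) : ℝ) / SC) * σB a ≤ (shufTerm c w cB : ℝ) := by
  have hS := SC_pos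
  have hce : ∀ a i : Fin 3, FI.mem ((c (Sum.inl (a, i)) : ℝ) / SC) (cenE c (a, i)) := fun a i => by
    unfold cenE
    exact mem_entryFI (by simp)
  have hshuf : ∀ i : Fin 3, SC * ((ξ i - (c (Sum.inr i) : ℝ) / SC) * ∑ a : Fin 3, ((c (Sum.inl (a, i)) : ℝ) / SC) * σB a) ≤
      ((cdiv (w (Sum.inr i) * FI.absHi ((((cenE c (0, i)).mul (cB.cS 0)).add ((cenE c (1, i)).mul (cB.cS 1))).add
        ((cenE c (2, i)).mul (cB.cS 2)))) SC : ℤ) : ℝ) := by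
    intro i
    have hm : FI.mem (∑ a : Fin 3, ((c (Sum.inl (a, i)) : ℝ) / SC) * σB a)
        ((((cenE c (0, i)).mul (cB.cS 0)).add ((cenE c (1, i)).mul (cB.cS 1))).add ((cenE c (2, i)).mul (cB.cS 2))) := by
      rw [Fin.sum_univ_three]
      exact FI.mem_add (FI.mem_add (FI.mem_mul (hce 0 i) (hσ 0)) (FI.mem_mul (hce 1 i) (hσ 1))) (FI.mem_mul (hce 2 i) (hσ 2))
    have habs := FI.abs_le_absHi hm
    have hΔ := hξ i
    have hc := div_le_cdiv (a := w (Sum.inr i) * FI.absHi ((((cenE c (0, i)).mul (cB.cS 0)).add ((cenE c (1, i)).mul (cB.cS 1))).add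
        ((cenE c (2, i)).mul (cB.cS 2)))) (b := SC) SCZ_pos
    push_cast at hc
    refine le_trans ?_ hc
    rw [le_div_iff₀ hS]
    have hwn : (0 : ℝ) ≤ (w (Sum.inr i) : ℝ) / SC := le_trans (abs_nonneg _) hΔ
    calc SC * ((ξ i - (c (Sum.inr i) : ℝ) / SC) * ∑ a : Fin 3, ((c (Sum.inl (a, i)) : ℝ) / SC) * σB a) * SC
        ≤ |SC * ((ξ i - (c (Sum.inr i) : ℝ) / SC) * ∑ a : Fin 3, ((c (Sum.inl (a, i)) : ℝ) / SC) * σB a) * SC| := le_abs_self _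
      _ = (|ξ i - (c (Sum.inr i) : ℝ) / SC| * SC) * (|∑ a : Fin 3, ((c (Sum.inl (a, i)) : ℝ) / SC) * σB a| * SC) := by
          simp only [abs_mul, abs_of_pos hS]; ring
      _ ≤ ((w (Sum.inr i) : ℝ) / SC * SC) * (FI.absHi ((((cenE c (0, i)).mul (cB.cS 0)).add ((cenE c (1, i)).mul (cB.cS 1))).add
            ((cenE c (2, i)).mul (cB.cS 2))) : ℝ) :=
          mul_le_mul (mul_le_mul_of_nonneg_right hΔ hS.le) habs (by positivity) (by positivity)
      _ = _ := by field_simp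
  rw [Finset.mul_sum, Fin.sum_univ_three]
  have e : (shufTerm c w cB : ℝ) =
      ((cdiv (w (Sum.inr 0) * FI.absHi ((((cenE c (0, 0)).mul (cB.cS 0)).add ((cenE c (1, 0)).mul (cB.cS 1))).add
        ((cenE c (2, 0)).mul (cB.cS 2)))) SC : ℤ) : ℝ) +
      ((cdiv (w (Sum.inr 1) * FI.absHi ((((cenE c (0, 1)).mul (cB.cS 0)).add ((cenE c (1, 1)).mul (cB.cS 1))).add
        ((cenE c (2, 1)).mul (cB.cS 2)))) SC : ℤ) : ℝ) +
      ((cdiv (w (Sum.inr 2) * FI.absHi ((((cenE c (0, 2)).mul (cB.cS 0)).add ((cenE c (1, 2)).mul (cB.cS 1))).add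
        ((cenE c (2, 2)).mul (cB.cS 2)))) SC : ℤ) : ℝ) := by
    unfold shufTerm
    push_cast
    ring
  rw [e]
  linarith [hshuf 0, hshuf 1, hshuf 2]

/-- ★ The BILINEAR first-order terms are dominated by `bilTerm`. [folklore] -/
theorem bil_term_bound {c w : (Fin 3 × Fin 3) ⊕ Fin 3 → ℤ} {U : E3 →L[ℝ] E3} {ξ : E3} {cB : FamCert} {σB : Fin 3 → ℝ}
    (hbox : ∀ ab : Fin 3 × Fin 3, |(U (EuclideanSpace.single ab.2 (1 : ℝ))) ab.1 - (c (Sum.inl ab) : ℝ) / SC| ≤ (w (Sum.inl ab) : ℝ) / SC)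
    (hξ : ∀ i : Fin 3, |ξ i - (c (Sum.inr i) : ℝ) / SC| ≤ (w (Sum.inr i) : ℝ) / SC) (hσ : ∀ a, FI.mem (σB a) (cB.cS a)) :
    SC * ∑ a : Fin 3, ∑ i : Fin 3, ((U (EuclideanSpace.single i (1 : ℝ))) a - (c (Sum.inl (a, i)) : ℝ) / SC) *
      (ξ i - (c (Sum.inr i) : ℝ) / SC) * σB a ≤ (bilTerm w cB : ℝ) := by
  have hS := SC_pos
  have hσabs : ∀ a : Fin 3, |σB a| * SC ≤ (FI.absHi (cB.cS a) : ℝ) := fun a => FI.abs_le_absHi (hσ a)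
  have hbil1 : ∀ a i : Fin 3, SC * (((U (EuclideanSpace.single i (1 : ℝ))) a - (c (Sum.inl (a, i)) : ℝ) / SC) *
      (ξ i - (c (Sum.inr i) : ℝ) / SC) * σB a) ≤ (FI.absHi (cB.cS a) : ℝ) * ((w (Sum.inl (a, i)) : ℝ) * (w (Sum.inr i) : ℝ)) / (SC * SC) := by
    intro a i
    have hΔu := hbox (a, i)
    have hΔx := hξ i
    rw [le_div_iff₀ (by positivity)]
    have h0u : (0 : ℝ) ≤ (w (Sum.inl (a, i)) : ℝ) / SC := le_trans (abs_nonneg _) hΔu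
    have h0x : (0 : ℝ) ≤ (w (Sum.inr i) : ℝ) / SC := le_trans (abs_nonneg _) hΔx
    calc SC * (((U (EuclideanSpace.single i (1 : ℝ))) a - (c (Sum.inl (a, i)) : ℝ) / SC) * (ξ i - (c (Sum.inr i) : ℝ) / SC) * σB a) * (SC * SC)
        ≤ |SC * (((U (EuclideanSpace.single i (1 : ℝ))) a - (c (Sum.inl (a, i)) : ℝ) / SC) * (ξ i - (c (Sum.inr i) : ℝ) / SC) * σB a) * (SC * SC)| :=
          le_abs_self _
      _ = (|(U (EuclideanSpace.single i (1 : ℝ))) a - (c (Sum.inl (a, i)) : ℝ) / SC| * SC) * (|ξ i - (c (Sum.inr i) : ℝ) / SC| * SC) *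
            (|σB a| * SC) := by
          simp only [abs_mul, abs_of_pos hS]; ring
      _ ≤ ((w (Sum.inl (a, i)) : ℝ) / SC * SC) * ((w (Sum.inr i) : ℝ) / SC * SC) * (FI.absHi (cB.cS a) : ℝ) := by
          refine mul_le_mul (mul_le_mul (mul_le_mul_of_nonneg_right hΔu hS.le) (mul_le_mul_of_nonneg_right hΔx hS.le)
            (by positivity) (by positivity)) (hσabs a) (by positivity) (by positivity)
      _ = (FI.absHi (cB.cS a) : ℝ) * ((w (Sum.inl (a, i)) : ℝ) * (w (Sum.inr i) : ℝ)) := by field_simp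
  have hc := div_sq_le_cdiv_cdiv (FI.absHi (cB.cS 0) * (w (Sum.inl (0, 0)) * w (Sum.inr 0) + w (Sum.inl (0, 1)) * w (Sum.inr 1) +
      w (Sum.inl (0, 2)) * w (Sum.inr 2)) + FI.absHi (cB.cS 1) * (w (Sum.inl (1, 0)) * w (Sum.inr 0) + w (Sum.inl (1, 1)) * w (Sum.inr 1) +
      w (Sum.inl (1, 2)) * w (Sum.inr 2)) + FI.absHi (cB.cS 2) * (w (Sum.inl (2, 0)) * w (Sum.inr 0) + w (Sum.inl (2, 1)) * w (Sum.inr 1) +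
      w (Sum.inl (2, 2)) * w (Sum.inr 2)))
  have e : (bilTerm w cB : ℝ) = ((cdiv (cdiv (FI.absHi (cB.cS 0) * (w (Sum.inl (0, 0)) * w (Sum.inr 0) + w (Sum.inl (0, 1)) * w (Sum.inr 1) +
      w (Sum.inl (0, 2)) * w (Sum.inr 2)) + FI.absHi (cB.cS 1) * (w (Sum.inl (1, 0)) * w (Sum.inr 0) + w (Sum.inl (1, 1)) * w (Sum.inr 1) +
      w (Sum.inl (1, 2)) * w (Sum.inr 2)) + FI.absHi (cB.cS 2) * (w (Sum.inl (2, 0)) * w (Sum.inr 0) + w (Sum.inl (2, 1)) * w (Sum.inr 1) +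
      w (Sum.inl (2, 2)) * w (Sum.inr 2))) SC) SC : ℤ) : ℝ) := rfl
  rw [e]
  refine le_trans ?_ hc
  rw [Finset.mul_sum]
  simp only [Fin.sum_univ_three]
  push_cast
  simp only [add_div, mul_add]
  linarith [hbil1 0 0, hbil1 0 1, hbil1 0 2, hbil1 1 0, hbil1 1 1, hbil1 1 2, hbil1 2 0, hbil1 2 1, hbil1 2 2]

/-- ★★★ **SOUNDNESS OF THE CENTRED LEAF FROM ITS PARTS** (same shape as `…HomForceNest.forceOut_sound_of_parts`). [folklore] -/
theorem forceOutC_sound_of_parts {en : Fin 3 → ℤ} {ed : ℕ} {sn : ℤ} {sd : ℕ} {c w : (Fin 3 × Fin 3) ⊕ Fin 3 → ℤ} {cA cB : FamCert}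
    (hdir : dirOK en ed = true) (hsd : 0 < sd) (hA : checkA en ed sn sd c w cA = true) (hB : checkB en ed sn sd c w cB = true)
    (htest : slopeTestOK (boundC c w cA cB) sn sd = true)
    (U : E3 →L[ℝ] E3) (ξ : E3) (hU : ‖U - 1‖ ≤ 1 / 4) (hξn : ‖ξ‖ ≤ 1 / 4)
    (hbox : ∀ ab : Fin 3 × Fin 3, |(U (EuclideanSpace.single ab.2 (1 : ℝ))) ab.1 - (c (Sum.inl ab) : ℝ) / SC| ≤ (w (Sum.inl ab) : ℝ) / SC)
    (hξ : ∀ i : Fin 3, |ξ i - (c (Sum.inr i) : ℝ) / SC| ≤ (w (Sum.inr i) : ℝ) / SC) :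
    ∀ (M : ℕ) (z : Fin M → E3) (cc : Fin M), Function.Injective z →
      Set.range z = {x : E3 | dist x (z cc) ≤ 133 / 10 ∧ ∃ a : Fin 3 → ℤ,
        x = z cc + latPt U hexFrame a ∨ x = z cc + latPt U hexFrame a + U (hcpShift + ξ)} →
      TightNearCap (9 / 5) (3 / 2) z cc ∨ ExemptNear (9 / 5) ExRec z cc ∨ BadNearCap (9 / 5) (3 / 2) z cc := by
  intro M z cc hz hrange
  obtain ⟨hed, he⟩ := norm_dirVec_le_one hdir
  obtain ⟨hs0, hs38, hG⟩ := lt_threshold_of_slopeTestOK hsd htest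
  have hS := SC_pos
  refine Or.inr (Or.inl (exemptNear_of_boxSlope hz hU hξn hrange (dirVec en ed) he (s := (sn : ℝ) / sd)
    (b := -((boundC c w cA cB : ℝ) / SC)) hs0 hs38 (fun τ hτ => ?_) ?_))
  · have e : ∀ v : E3, (if v ≠ 0 ∧ ‖v‖ ≤ 7 then
        ((‖τ • dirVec en ed - v‖⁻¹) ^ 8 - (‖τ • dirVec en ed - v‖⁻¹) ^ 14) * ⟪τ • dirVec en ed - v, dirVec en ed⟫ else 0) =
        cutSlope v (dirVec en ed) τ := fun v => rfl
    simp only [e]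
    rw [neg_neg, le_div_iff₀ hS, ← box11_eq]
    -- the centre map and the centre shuffle
    obtain ⟨U₀, hU₀⟩ := exists_clm_of_entries (fun ab : Fin 3 × Fin 3 => (c (Sum.inl ab) : ℝ) / SC)
    have hξ₀ : ∀ i : Fin 3, ((EuclideanSpace.equiv (Fin 3) ℝ).symm (fun i => (c (Sum.inr i) : ℝ) / SC) : E3) i = (c (Sum.inr i) : ℝ) / SC :=
      fun i => rfl
    unfold checkA at hA
    unfold checkB at hB
    obtain ⟨hokA, hvA, hnA, hrA, hKA, -⟩ := check_sound hA
    obtain ⟨hokB, hvB, hnB, hrB, hKB, hSB⟩ := check_sound hB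
    obtain ⟨κA, σA, hκA, -, hinA⟩ := famA_sound hed hsd hτ.1 hτ.2 hU hbox hU₀ hokA
    obtain ⟨κB, σB, hκB, hσB, hinB⟩ := famB_sound hed hsd hτ.1 hτ.2 hU hξn hbox hξ hU₀ hξ₀ hokB
    have hmA : ∀ ac, FI.mem (κA ac) (cA.cK ac) := fun ac => mem_of_subFI (hκA ac) (hKA ac)
    have hmB : ∀ ac, FI.mem (κB ac) (cB.cK ac) := fun ac => mem_of_subFI (hκB ac) (hKB ac)
    have hmS : ∀ a, FI.mem (σB a) (cB.cS a) := fun a => mem_of_subFI (hσB a) (hSB a)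
    have hent := entry_term_bound (cA := cA) (cB := cB) hbox hmA hmB
    have hshuf := shuf_term_bound (w := w) hξ hmS
    have hbil := bil_term_bound hbox hξ hmS
    generalize famA en ed sn sd c w = FA at hinA hvA hnA hrA
    generalize famB en ed sn sd c w = FB at hinB hvB hnB hrB
    have hrem : (FA.rem : ℝ) / 2 + (FB.rem : ℝ) / 2 ≤ ((cdiv (cA.crem + cB.crem) 2 : ℤ) : ℝ) := by
      have hc := div_le_cdiv (a := cA.crem + cB.crem) (b := 2) (by norm_num)
      push_cast at hc
      have h1 : (FA.rem : ℝ) ≤ cA.crem := by exact_mod_cast hrA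
      have h2 : (FB.rem : ℝ) ≤ cB.crem := by exact_mod_cast hrB
      linarith
    have hv1 : (FA.val : ℝ) ≤ cA.cval := by exact_mod_cast hvA
    have hv2 : (FB.val : ℝ) ≤ cB.cval := by exact_mod_cast hvB
    have hn1 : (FA.nv : ℝ) ≤ cA.cnv := by exact_mod_cast hnA
    have hn2 : (FB.nv : ℝ) ≤ cB.cnv := by exact_mod_cast hnB
    have hsumK : SC * ∑ ac : Fin 3 × Fin 3, ((U (EuclideanSpace.single ac.2 (1 : ℝ))) ac.1 - (c (Sum.inl ac) : ℝ) / SC) * κA ac +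
        SC * ∑ ac : Fin 3 × Fin 3, ((U (EuclideanSpace.single ac.2 (1 : ℝ))) ac.1 - (c (Sum.inl ac) : ℝ) / SC) * κB ac =
        SC * ∑ ac : Fin 3 × Fin 3, ((U (EuclideanSpace.single ac.2 (1 : ℝ))) ac.1 - (c (Sum.inl ac) : ℝ) / SC) * (κA ac + κB ac) := by
      rw [← mul_add, ← Finset.sum_add_distrib]
      refine congrArg _ (Finset.sum_congr rfl fun ac _ => by ring)
    have htot : (boundC c w cA cB : ℝ) = (cA.cval : ℝ) + cB.cval + cA.cnv + cB.cnv + ((cdiv (cA.crem + cB.crem) 2 : ℤ) : ℝ) +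
        (entryTerm w cA cB : ℝ) + (shufTerm c w cB : ℝ) + (bilTerm w cB : ℝ) := by
      unfold boundC; push_cast; ring
    rw [htot, add_mul]
    linarith [hinA, hinB, hent, hshuf, hbil, hrem, hv1, hv2, hn1, hn2, hsumK]
  · have hs0' : (0 : ℝ) < (sn : ℝ) / sd := hs0
    nlinarith [hG, hs0']

end Summit.AtomisticToContinuum.Crystallization.Theorems.FrustratedLawDichotomyStrainedPatchHomForceCentredFinal
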